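import Summits.CriticalPhenomena.SAWScalingLimit.Theses.SAWRenewalTightness
import Summits.CriticalPhenomena.SAWScalingLimit.Theorems.ShellCrossingBound.Negative.OfEventualTight

/-!
# Line `kesten-defect-renewal` for crux `SAWRenewalTightness.ShellCrossingBound` (stmt-CriticalPhenomena-4728)

Planner skeleton (crux-plan, round 1; idea `kesten-defect-renewal`, triage r1-1/2/3: pass ×3 as the
ENGINE of the merged line "KS non-degeneracy via dead-end pockets" = this card + `markov-fibration-pocket`).

THE LINE (bottom-up; every stub is stated over TREE VOCABULARY ONLY — `SAW.IsIrrBridge`, `SAW.traj`,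
`SAW.xEnd`, `SAW.Zd.bridges`, `SAW.Zd.sawFun`, `SAW.criticalFugacity`, `SAW.law`, `Curve.HasTraversals`,
the route items `EventualTight` / `ShellCrossingBound` — so that each stub lands verbatim as
`Theorems/SAWRenewalTightnessShellCrossingBound<Stub>.lean` with `--supports stmt-CriticalPhenomena-4728`
without importing this workfile):

* S1 `stub_irrBridgeTiltedKraft` — THE LEVER (open; ≍ hyperscaling `ξ_W(x_c) = O(W)`): a tilted Kraft
  inequality for Kesten's `x_c`-weighted irreducible bridges confined to the width-`W` strip: for one
  absolute `c > 0`, every finite set of irreducible bridges fitting in heights `[0, W)` from start height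
  `y` has `Σ x_c^{|β|} e^{c·span(β)/W} ≤ 1`. Untilted and unconfined the full sum is `1` exactly (Kesten's
  identity, route support item `KestenIdentity`, MadrasSlade1993 (4.2.4)); the tilt in `span/W` is paid
  by the confinement defect `θ_W(y) = P_irr[does not fit]`. It is the MAX-ROW-SUM (Kraft) criterion for
  the tilted irreducible strip kernel `K_W(e^{c/W})`, threshold `c_K(W) ≤ W·M_W(x_c)` (triage r1-2).
* S2 `stub_stripDecay_of_tiltedKraft` (provable now, M–L; renewal algebra): S1 ⇒ the `x_c`-mass of
  strip bridges of span `L` from height `y` to height `y'` is `≤ A·W·e^{-cL/W}` (rate `c/(2W)` from the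
  original `c`, amplitude linear in `W`): unique factorisation of a strip bridge into PLANE-irreducible
  bridges that each fit (`SAW.eq_of_append_eq` + existence by induction on break points), row sums of
  `K_W(t)` at `t = e^{c/(2W)}` are `≤ e^{-c/(2W)} =: q < 1` (every span is `≥ 1`), Neumann series
  `Σ_k q^k ≤ 1/(e^{c/(2W)} - 1) ≤ 2W/c`.
* S3 `stub_tubeMass_of_stripDecay` (provable now, M; Fekete + reflect-and-Schwarz): amplitude removal —
  ANY bound `A·W·e^{-cL/W}` on confined bridge masses upgrades to `A'·e^{-cL/W}` (`A' = x_c^{-1/2}`):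
  `u_L(y,y)` is supermultiplicative in `L` (concatenation), so Fekete gives `u_L(y,y) ≤ e^{-cL/W}` for ALL
  `L`; off the diagonal `u_L(y,y')² ≤ x_c^{-1} u_{2L+1}(y,y)` (bridge, one `e₁` step, mirrored reversed
  bridge; MadrasSlade1993 Lemma 4.1.12). Output = `TubeMassHyperscaling`: `W·M_W(x_c) ≥ c`, the RATE that
  MadrasSlade1993 Lemma 4.1.11 (`M_T(z_c) ↓ 0`) leaves open; numerically `M_W·(W+1) = 1.946…1.956`
  (W = 2…5, ideator toy, kit j008766) vs Cardy `π·5/8 = 1.9635`.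
* S4 `stub_hairpin_of_tubeMass` (OPEN, L–XL: the base-scale closing comparison): hyperscaling ⇒
  `HairpinHysteresis` at SOME aspect ratio `C₀ ≥ 2` (card A's atom with `2W ↦ C₀W`, weaker, still what KS
  consumes): in the half-strip pocket of width `W`, mouth-to-mouth SAWs reaching depth `≥ C₀W` have mass
  `≤ η < 1` times those reaching depth `≥ W`, uniformly in `W` and the mouth points. The deep hairpin
  contains a clean strip bridge of span `(C₀-1)W` beyond the walk's own clutter (which stays at depth
  `< W` up to the first passage of depth `W`, exact domain Markov), so S3 pays `e^{-c(C₀-1)}` FLAT in `W`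
  for the numerator (with `Σ_{y'} u_L(y,y') ≤ 1`, route support `StripMassConservation`, absorbing the exit
  height); the denominator needs a FLOOR of the same shape — shallow hairpins of depth `≍ W` from the
  entry height to a decorrelated exit height, in the mouth box with the walk's own clutter — i.e. an
  RSW-type quasi-multiplicativity for `x_c`-SAW at aspect ratio 1. That floor is NOT supplied by this card
  (flagged by all three triagers; it is card `markov-fibration-pocket`'s MSPL business) and is the honest
  open content of S4.
* S5 `stub_perShellDecay_of_hairpin` (OPEN, XL = line `markov-fibration-pocket`'s upper floor, docked here
  BY DESIGN: its `NonDegeneracyEta`/`ChainA₁` decompose this stub): strip hyperscaling + hairpin hysteresis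
  ⇒ rate-free per-shell decay of `k`-fold traversals for the critical SAW in every Dobrushin domain —
  Kemppainen–Smirnov non-degeneracy (time-zero G1 with any constant `η < 1`, KS17 Cor. 2.6) for the
  Markov-closed family of LATTICE slit domains (cell domains with walls on non-edges, start on the slit
  tip — the family repair demanded by triage r1-1/2/3), every avoidable component being the mouth of a
  dead-end pocket in a simply connected slit domain, then KS17 Lemma 3.6 / Prop. 3.5 shell by shell
  (forced count `n₀(shell)` finite uniformly in `δ ≤ δ₀(shell)`). `PerShellDecay` is typed IDENTICALLY to
  `SketchIdeator1.PerShellDecay` so the two lines share the item.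
* S6 `stub_eventualTight_of_perShellDecay` (provable now, M–L): per-shell decay ⇒ `EventualTight` by
  Aizenman–Burchard (2.22) (`Curve.tortuosity_le_of_cover`, proved) scale by scale on finite nets of
  `closure Ω`, a union bound with `ε 2^{-m-1}/|S_m|` per shell, and AB Lemma 4.1
  (`CurveClass.isCompact_closure_image_mk_of_tortuosity_le`, proved).
* `ShellCrossingBound_of` (PROVED here): S6 ∘ S5 ∘ S4 ∘ S3 ∘ S2 ∘ S1 gives `EventualTight`, and the LANDED
  negative lemma `Negative.not_eventualTight_of_not_shellCrossingBound` (p72603; Disproof.lean §2: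
  the crux ⟺ T′) turns it into the crux BY NAME.

Disproof.lean (cdisprove cycle 1, read 2026-08-16): no `_false_without_<H>` theorem exists for this crux
(§3 finding) — nothing to honour stub-wise; USED: §2 `shellCrossingBound ⟺ EventualTight` (the composition
goes through `EventualTight` on purpose: the AB dress `K, λ>2, δ≤ρ, R≤1` is decorative,
`anyExponent_of_eventualTight`), §4 `not_shellCrossingBoundUniformK` (no stub asks a shell-uniform
threshold: S5/S6 produce a per-shell `k`), §5 (S5's KS mechanism yields the Bulk half with `k₀` uniform on
interior shells as a by-product, not claimed here). Landed Negative lemmas checked against: `OfEventualTight`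
(imported and used), `RadiiThreshold`, `UniformThresholdFalse`/`Forcing*` (no stub is an instance: all
thresholds here are per shell). Negatives index (`ledger negatives`, 9 items; nearby only stmt-0772, the all-`δ` `Tight`, and stmt-8261, a positive-type claim nothing here makes): every
law-level statement here has the eventual quantifier `∃ δ₀`; S1–S4 are lattice-unit statements untouched by
any recorded witness.
-/

namespace Summit.CriticalPhenomena.SAWScalingLimit.Cruxes.ShellCrossingBound.KestenDefectRenewal

open scoped BigOperators Classical ENNReal
open MeasureTheory Set
open Literature.Probability.LatticeModels Literature.Probability.RandomPlanarGeometry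
open Summit.CriticalPhenomena.SAWScalingLimit.Theses.SAWRenewalTightness (EventualTight ShellCrossingBound)

/-! ## The stubs

Vocabulary. Heights are coordinate `1`, spans/depths coordinate `0` of `Site 2 = Fin 2 → ℤ`.
"Strip bridge of span `L` from height `y` to height `y'` in width `W`": `ω ∈ SAW.Zd.bridges 2 n`
(vertex function from `0`, `0 < ω i 0 ≤ ω n 0` for `1 ≤ i ≤ n`) with `ω n 0 = L`, `y + ω n 1 = y'` and
`0 ≤ y + ω i 1 < W` for all `i ≤ n`; its `x_c`-mass `u^W_L(y,y')` is the sum of `x_c^n` over `n` and such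
`ω` (all partial sums in `n`, junk-free). "Fits from `y` in width `W`" for a step word `w`:
`0 ≤ y + (SAW.traj w i) 1 < W` for all `i ≤ |w|`. -/

/-- **S1 — TILTED KRAFT INEQUALITY FOR KESTEN'S IRREDUCIBLE BRIDGES IN A STRIP (the lever; OPEN,
hardest estimate of the engine).** There is an absolute `c > 0` such that for every width `W ≥ 1`,
every start height `0 ≤ y < W` and every finite set `s` of irreducible bridges (step words,
`SAW.IsIrrBridge`: self-avoiding, bridge, no break point, non-empty), the members of `s` that fit in
heights `[0, W)` when started at height `y` satisfy
`Σ x_c^{|β|} · exp(c · span(β) / W) ≤ 1` (`span = SAW.xEnd`, `x_c = SAW.criticalFugacity`).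
Why plausibly true: untilted and unconfined the full sum is EXACTLY `1` (Kesten 1963; MadrasSlade1993
(4.2.4): `A(z_c) = 1`), so the fitting mass is `1 - θ_W(y)` with defect `θ_W(y) = P_irr[β + (0,y) leaves
the strip] > 0`; predicted `θ_W ≍ W^{-3/4}` in the bulk (span tail `P_irr[span ≥ ℓ] ≍ ℓ^{-3/4}` ⇔
`u_L ≍ L^{-1/4}`, DGKLP arXiv:1008.4321) while the tilt costs `Σ_fits x_c^n (e^{c·span/W} - 1) ≍
F(c)·W^{-3/4}` with `F(c) → 0` as `c → 0` — the same power of `W` on both sides, room in the constant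
only. Small cases (triage r1-2/3, by hand): `W = 1`: only `E` fits, `c ≤ log μ = 0.970`; `W = 2, y = 0`:
`{E, EN}`, `c ≤ 1.297`; `W = 3, y = 1`: `{E, EN, ES}`, `c ≤ 1.218`. It is the max-row-sum criterion for the
tilted fitting-irreducible kernel `K_W(e^{c/W})`, hence `c_K(W) ≤ W·M_W(x_c)` (Collatz–Wielandt); the claim
is `inf_W c_K(W) > 0`. Why it might fail: the Kraft threshold may drift to `0` although the Perron
threshold `W·M_W → π·5/8` does not (rows near `y ≈ W/2` carry the smallest defect); falsifier: strip
transfer matrix, `min_y` row-sum threshold for `W ≤ 10`. If it fails, replace S1+S2 by the spectral form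
(S2's conclusion, or `TubeMassHyperscaling` directly) — the composition is unchanged.
Sources: Kesten1963SAW §4; MadrasSlade1993 Def. 4.1.10, Lemma 4.1.11, §4.2 (4.2.2)–(4.2.4), Thm 8.2.1
(8.2.15)–(8.2.16); arXiv:1008.4321. -/
theorem stub_irrBridgeTiltedKraft :
    ∃ c : ℝ, 0 < c ∧ ∀ W : ℕ, 1 ≤ W → ∀ y : ℤ, 0 ≤ y → y < W →
      ∀ s : Finset {w : List SAW.Step // SAW.IsIrrBridge w},
        (∑ w ∈ s with (∀ i ≤ w.1.length, 0 ≤ y + SAW.traj w.1 i 1 ∧ y + SAW.traj w.1 i 1 < W),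
          SAW.criticalFugacity ^ w.1.length * Real.exp (c * (SAW.xEnd w.1 : ℝ) / W)) ≤ 1 := by
  sorry

/-- **S2 — STRIP RENEWAL: tilted Kraft ⇒ exponential decay of confined bridge masses at rate `∝ 1/W`
with amplitude linear in `W` (provable now, M–L).** If S1 holds then there are `c > 0` and `A` such that
for all `W ≥ 1`, heights `0 ≤ y, y' < W`, spans `L ≥ 1`: `u^W_L(y, y') ≤ A · W · exp(-c L / W)` (all
partial sums). Proof route (MadrasSlade1993 §4.2 renewal, run INSIDE the strip at the PLANE's `x_c`):
(i) a strip bridge word `w` from height `y` factors uniquely as `β₁ ⋯ β_k` into irreducible bridges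
(existence: split at a break point `SAW.IsBreak`, both halves are bridges, induct on length; uniqueness:
`SAW.eq_of_append_eq`), and each `β_j`, started at the height where it starts inside `w`, fits in
`[0, W)`; (ii) with `c₁` from S1 put `t := e^{c₁/(2W)}`; every span is `≥ 1`, so
`x_c^{|β|} t^{span β} ≤ e^{-c₁/(2W)} · x_c^{|β|} e^{c₁ span/W}` and S1 makes every "row sum"
`Σ_{β fits from y''} x_c^{|β|} t^{span} ≤ q := e^{-c₁/(2W)} < 1`; (iii) induction on the word length `N`:
`S_N(y) := Σ_{fitting bridge words from y, 1 ≤ |w| ≤ N} x_c^{|w|} t^{xEnd w} ≤ q (1 + sup_{y''} S_{N-1}(y''))`,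
hence `S_N ≤ q/(1-q) ≤ 2W/c₁`; (iv) restrict to span `L`: `Σ x_c^{|w|} ≤ t^{-L} · 2W/c₁ =
(2/c₁) · W · e^{-c₁ L/(2W)}`; (v) transport words ↔ vertex functions (`SAW.traj`, `SAW.wordOf`,
`SAW.traj_mem_bridges`, `SAW.Zd.mem_bridges`). Constants: `c = c₁/2`, `A = 2/c₁`. Kesten's identity itself
is NOT needed (S1 already bounds the untilted rows by `1`). Sources: MadrasSlade1993 §4.2 (4.2.2)–(4.2.12);
Kesten1963SAW §4; tree `SAWWordBridges.lean`. -/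
theorem stub_stripDecay_of_tiltedKraft :
    (∃ c : ℝ, 0 < c ∧ ∀ W : ℕ, 1 ≤ W → ∀ y : ℤ, 0 ≤ y → y < W →
      ∀ s : Finset {w : List SAW.Step // SAW.IsIrrBridge w},
        (∑ w ∈ s with (∀ i ≤ w.1.length, 0 ≤ y + SAW.traj w.1 i 1 ∧ y + SAW.traj w.1 i 1 < W),
          SAW.criticalFugacity ^ w.1.length * Real.exp (c * (SAW.xEnd w.1 : ℝ) / W)) ≤ 1) →
    ∃ c : ℝ, 0 < c ∧ ∃ A : ℝ, ∀ W : ℕ, 1 ≤ W → ∀ y y' : ℤ, 0 ≤ y → y < W → 0 ≤ y' → y' < W →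
      ∀ L : ℕ, 1 ≤ L → ∀ N : ℕ,
        (∑ n ∈ Finset.range (N + 1),
          ∑ _ω ∈ (SAW.Zd.bridges 2 n).filter (fun ω =>
              ω n 0 = (L : ℤ) ∧ y + ω n 1 = y' ∧ ∀ i ≤ n, 0 ≤ y + ω i 1 ∧ y + ω i 1 < W),
            SAW.criticalFugacity ^ n) ≤ A * W * Real.exp (-(c * L / W)) := by
  sorry

/-- **S3 — AMPLITUDE REMOVAL: Fekete on the diagonal + reflect-and-Schwarz (provable now, M).**
If confined bridge masses satisfy `u^W_L(y,y') ≤ A · W · e^{-cL/W}` (S2's conclusion; any `A`, any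
polynomial-type amplitude would do) then `u^W_L(y,y') ≤ A' · e^{-cL/W}` with the SAME rate and an
ABSOLUTE amplitude (`A' = x_c^{-1/2}`): this is `TubeMassHyperscaling`, i.e. `W · M_W(x_c) ≥ c` with the
truncated bridge mass `M_T` of MadrasSlade1993 Def. 4.1.10 / Lemma 4.1.11 (there: `M_T(z_c) ↓ 0`, no
rate). Proof route: (i) `u_L(y,y) := Σ_n Σ_{strip bridges span L, y → y} x_c^n` (full sum = `⨆` of the
bounded partial sums) is positive (`≥ x_c^L`, straight walk) and supermultiplicative,
`u_{L+M}(y,y) ≥ u_L(y,y) u_M(y,y)` (concatenate: the second bridge lives in the slab `x > L`,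
`SAW.Zd.concatWalk`, `concatWalk_mem_saws`; injective: cut at the last time with `x ≤ L`);
(ii) Fekete (`Subadditive` in Mathlib, on `a_L := -log u_L(y,y)`): `a_L / L ≥ lim_M a_M / M ≥ c/W`
because `a_M ≥ cM/W - log(A W)`; so `u_L(y,y) ≤ e^{-cL/W}` for EVERY `L ≥ 1` — amplitude `1`;
(iii) off-diagonal: `(ω₁, ω₂) ↦ ω₁ · e₁ · (mirror of reversed ω₂ in x = L + 1/2)` injects pairs of strip
bridges `y → y'` of span `L` into strip bridges `y → y` of span `2L+1` (MadrasSlade1993 Lemma 4.1.12;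
tree `SAW.Zd.reflAt`, `SAWReflect.lean`), so `u_L(y,y')² ≤ x_c^{-1} u_{2L+1}(y,y) ≤ x_c^{-1} e^{-c(2L+1)/W}`.
An unconditional little theorem (true whatever S1's fate). Sources: MadrasSlade1993 Lemma 4.1.11,
Lemma 4.1.12, (4.1.16); Fekete. -/
theorem stub_tubeMass_of_stripDecay :
    (∃ c : ℝ, 0 < c ∧ ∃ A : ℝ, ∀ W : ℕ, 1 ≤ W → ∀ y y' : ℤ, 0 ≤ y → y < W → 0 ≤ y' → y' < W →
      ∀ L : ℕ, 1 ≤ L → ∀ N : ℕ,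
        (∑ n ∈ Finset.range (N + 1),
          ∑ _ω ∈ (SAW.Zd.bridges 2 n).filter (fun ω =>
              ω n 0 = (L : ℤ) ∧ y + ω n 1 = y' ∧ ∀ i ≤ n, 0 ≤ y + ω i 1 ∧ y + ω i 1 < W),
            SAW.criticalFugacity ^ n) ≤ A * W * Real.exp (-(c * L / W))) →
    ∃ c : ℝ, 0 < c ∧ ∃ A : ℝ, ∀ W : ℕ, 1 ≤ W → ∀ y y' : ℤ, 0 ≤ y → y < W → 0 ≤ y' → y' < W →
      ∀ L : ℕ, 1 ≤ L → ∀ N : ℕ,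
        (∑ n ∈ Finset.range (N + 1),
          ∑ _ω ∈ (SAW.Zd.bridges 2 n).filter (fun ω =>
              ω n 0 = (L : ℤ) ∧ y + ω n 1 = y' ∧ ∀ i ≤ n, 0 ≤ y + ω i 1 ∧ y + ω i 1 < W),
            SAW.criticalFugacity ^ n) ≤ A * Real.exp (-(c * L / W)) := by
  sorry

/-- **S4 — HYPERSCALING ⇒ HAIRPIN HYSTERESIS AT SOME ASPECT RATIO (OPEN, L–XL: contains the
base-scale closing comparison).** If `TubeMassHyperscaling` holds (S3's conclusion) then there are an
aspect ratio `C₀ ≥ 2` and `η < 1` such that for every width `W ≥ 1` and mouth points `p = (0, y₁)`,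
`q = (0, y₂)` (`y₁ ≠ y₂ < W`) of the half-strip pocket `P_W = {v : 0 ≤ v₀, 0 ≤ v₁ < W}` (depth `v₀`,
mouth line `v₀ = 0`): the `x_c`-mass of SAWs `p → q` inside `P_W` reaching depth `≥ C₀ W` is at most
`η ×` the mass of those reaching depth `≥ W` (partial-sum form: every partial sum of the deep mass is
`≤ η ×` some partial sum of the other; both full sums are finite since `μ(P_W) < μ`). This is card
`markov-fibration-pocket`'s atom `HairpinHysteresis` with `2W ↦ C₀ W` (formally weaker: `∃ C₀`; KS consume
any fixed aspect ratio, KS17 Condition G1 "∃ C > 1"). Degenerate cases: `W = 1` vacuous; `W = 2`: one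
U-walk per depth, ratio `= x_c^{2(C₀-1)W} ≤ x_c⁴ ≈ 0.02`; predicted limit a constant `η₀(C₀) < 1`,
`→ 0` as `C₀ → ∞` (2-strand strip correlation length `O(W)`); ideator's 1-strand proxy `D(2W)/D(W) =
0.27, 0.23, 0.21` (`W = 2,3,4`). What S3 gives and what it does not: condition on the walk up to its FIRST
passage `A` to depth `W` and after its LAST passage `A'` (exact domain Markov; `A, A'` live at depth
`< W`); a deep middle piece contains a strip bridge of span `(C₀-1)W` in the clutter-free region beyond
column `W`, so S3 + `Σ_{y'} u_L(y,y') ≤ 1` (route support `StripMassConservation`) bound the deep mass by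
`x_c^{-1/2} e^{-c(C₀-1)} ×` (entry-leg mass) × (exit-leg mass) FLAT in `W`; the missing half is a FLOOR for
the shallow middle pieces of the same product shape — a hairpin of depth `≍ W` from the entry height to a
decorrelated exit height inside `P_W ∖ (A ∪ A')` — i.e. RSW-type quasi-multiplicativity for `x_c`-SAW at
aspect ratio `1`, uniformly over the walk's own clutter in the mouth box. Not in print on any lattice for
SAW; this is the honest open content of S4 (triage r1-1/2/3: "the closing comparison", "MSPL uniformity
over clutter"). Why it might fail AS A LEMMA: only if hairpin hysteresis itself fails (then every KS-type
line dies, and so does SLE₈⸝₃-type behaviour in fjords). Sources: KemppainenSmirnov2017 (arXiv:1212.6215)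
§1.1 (G1), Cor. 2.6; MadrasSlade1993 §8.2 (strips); DuminilCopinHammond2013 / arXiv:1305.1257 (the only
unconditional `x_c`-surgery on `ℤ²`, polynomial losses). -/
theorem stub_hairpin_of_tubeMass :
    (∃ c : ℝ, 0 < c ∧ ∃ A : ℝ, ∀ W : ℕ, 1 ≤ W → ∀ y y' : ℤ, 0 ≤ y → y < W → 0 ≤ y' → y' < W →
      ∀ L : ℕ, 1 ≤ L → ∀ N : ℕ,
        (∑ n ∈ Finset.range (N + 1),
          ∑ _ω ∈ (SAW.Zd.bridges 2 n).filter (fun ω =>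
              ω n 0 = (L : ℤ) ∧ y + ω n 1 = y' ∧ ∀ i ≤ n, 0 ≤ y + ω i 1 ∧ y + ω i 1 < W),
            SAW.criticalFugacity ^ n) ≤ A * Real.exp (-(c * L / W))) →
    ∃ (C₀ : ℕ) (η : ℝ), 2 ≤ C₀ ∧ η < 1 ∧ ∀ W : ℕ, 1 ≤ W → ∀ y₁ y₂ : ℕ, y₁ < W → y₂ < W → y₁ ≠ y₂ →
      ∀ N : ℕ, ∃ N' : ℕ,
        (∑ n ∈ Finset.range (N + 1),
          ∑ _ω ∈ (SAW.Zd.sawFun 2 n (![0, (y₂ : ℤ)] - ![0, (y₁ : ℤ)])).filter (fun ω =>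
              (∀ i ≤ n, 0 ≤ (![0, (y₁ : ℤ)] + ω i) 0 ∧ 0 ≤ (![0, (y₁ : ℤ)] + ω i) 1 ∧
                (![0, (y₁ : ℤ)] + ω i) 1 < W) ∧
              (∃ i ≤ n, (C₀ : ℤ) * W ≤ (![0, (y₁ : ℤ)] + ω i) 0)),
            SAW.criticalFugacity ^ n)
        ≤ η * ∑ n ∈ Finset.range (N' + 1),
          ∑ _ω ∈ (SAW.Zd.sawFun 2 n (![0, (y₂ : ℤ)] - ![0, (y₁ : ℤ)])).filter (fun ω =>
              (∀ i ≤ n, 0 ≤ (![0, (y₁ : ℤ)] + ω i) 0 ∧ 0 ≤ (![0, (y₁ : ℤ)] + ω i) 1 ∧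
                (![0, (y₁ : ℤ)] + ω i) 1 < W) ∧
              (∃ i ≤ n, (W : ℤ) ≤ (![0, (y₁ : ℤ)] + ω i) 0)),
            SAW.criticalFugacity ^ n := by
  sorry

/-- **S5 — KS NON-DEGENERACY VIA DEAD-END POCKETS ⇒ RATE-FREE PER-SHELL DECAY (OPEN, XL; the upper floor
of line `markov-fibration-pocket`, docked here on purpose).** If `TubeMassHyperscaling` (S3) and hairpin
hysteresis at some aspect ratio (S4) hold, then `PerShellDecay`: for every Dobrushin domain and endpoint
approximation there is `δ₀ > 0` such that for every FIXED genuine shell `D(x; ρ, R)` and every `ε > 0`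
some threshold `k` makes `P_δ[k separate traversals by the SAW polyline] ≤ ε` for all `δ ∈ (0, δ₀]`
(typed verbatim as `SketchIdeator1.PerShellDecay`; equivalent to the crux by Disproof.lean §2 + AB, so this
stub carries the crux-level difficulty of the KS programme for SAW — it is NOT claimed cheap).
Mechanism (KemppainenSmirnov2017 §§2–3, run on SAW exactness): (a) exact domain Markov: conditionally on the
walk up to the hitting time of a closed set, the future is the critical SAW in the LATTICE slit graph from
the tip; (b) the Markov-closed family must be typed lattice-faithfully — cell domains of finite subgraphs of
`ℤ²` WITH WALLS on deleted edges (the mesh graph of a Jordan domain is not induced: `meshGraph` drops an edge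
whose closed segment leaves `closure Ω`; slits are invisible to `meshGraph`, so walls are thin closed
slivers), start at the slit tip, component of the target (`meshDomain` = largest component would give the
junk law `0`) — triage r1-1 (a), r1-2 sharpen (1)–(3), r1-3 sharpen, StartGapWitness.md; (c) in a simply
connected slit domain with boundary marked points every avoidable component of `U ∩ A(z₀,r,C₀ r)` (KS Def.
2.3, `unforcedPartZero` taken in the CELL domain, never in `D.carrier ∖ past`) is the mouth of a dead-end
pocket, so an unforced crossing is a hairpin into a dead end of aspect ratio `≥ C₀`; (d) MSPL: its
conditional probability is `≤ η < 1` uniformly over pocket shape and clutter — S4 is the straight-pocket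
atom and S3 the rate inside straight stretches; the shape/clutter uniformity ("KS Condition C in other
words", triage r1-1 (b)) is the declared risk; (e) KS17 Lemma 3.6 / Prop. 3.5 per shell: `P[≥ n₀(S) + 2n`
traversals`] ≤ η'^n` with the forced count `n₀(S)` finite per genuine shell uniformly in `δ ≤ δ₀(S)` (one
fixed polygonal `a → b` route of `D`; KS's `n₀ ≤ 2` needs uniformisation and is not used), `δ ∈ (δ₀(S),
δ₀]` absorbed by `|Ω_δ| ≤ C δ₀(S)^{-2}`; (f) START SEALING is load-bearing (TRIAGE-r1-3 gen 2, App. C):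
`IsEndpointApprox` allows `dist(δ·a_δ, ∂Ω) ≍ δ`, a positive-probability past then turns the start gap into a
one-vertex pinhole and a lattice-avoidable pocket mouth is crossed with conditional probability
`1 - O(δ^{5/4})`, so the conditional `η`-bound of (d) is run only from the first exit of the start cell's
boundary component / after a comparison with a boundary-start law (card A's sealing step, sibling's
foreseen `AdmissibleComparison`); per FIXED shell this costs a bounded number of pseudo-forced crossings,
which the shell-dependent `k` absorbs. By-product not claimed: Disproof §5 `ShellCrossingBoundBulk` with
`k₀` uniform on interior shells. Sources: KemppainenSmirnov2017 Def. 2.3, Cor. 2.6, Lemma 3.6, Prop. 3.5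
(pp. 14–15), §4 (SAW absent); LawlerSchrammWerner2004SAW §3.4; sibling item KSAdmissibleG1
(stmt-CriticalPhenomena-11346); card markov-fibration-pocket (SketchIdeator1 `NonDegeneracyEta`, `ChainA₁`). -/
theorem stub_perShellDecay_of_hairpin :
    (∃ c : ℝ, 0 < c ∧ ∃ A : ℝ, ∀ W : ℕ, 1 ≤ W → ∀ y y' : ℤ, 0 ≤ y → y < W → 0 ≤ y' → y' < W →
      ∀ L : ℕ, 1 ≤ L → ∀ N : ℕ,
        (∑ n ∈ Finset.range (N + 1),
          ∑ _ω ∈ (SAW.Zd.bridges 2 n).filter (fun ω =>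
              ω n 0 = (L : ℤ) ∧ y + ω n 1 = y' ∧ ∀ i ≤ n, 0 ≤ y + ω i 1 ∧ y + ω i 1 < W),
            SAW.criticalFugacity ^ n) ≤ A * Real.exp (-(c * L / W))) →
    (∃ (C₀ : ℕ) (η : ℝ), 2 ≤ C₀ ∧ η < 1 ∧ ∀ W : ℕ, 1 ≤ W → ∀ y₁ y₂ : ℕ, y₁ < W → y₂ < W → y₁ ≠ y₂ →
      ∀ N : ℕ, ∃ N' : ℕ,
        (∑ n ∈ Finset.range (N + 1),
          ∑ _ω ∈ (SAW.Zd.sawFun 2 n (![0, (y₂ : ℤ)] - ![0, (y₁ : ℤ)])).filter (fun ω =>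
              (∀ i ≤ n, 0 ≤ (![0, (y₁ : ℤ)] + ω i) 0 ∧ 0 ≤ (![0, (y₁ : ℤ)] + ω i) 1 ∧
                (![0, (y₁ : ℤ)] + ω i) 1 < W) ∧
              (∃ i ≤ n, (C₀ : ℤ) * W ≤ (![0, (y₁ : ℤ)] + ω i) 0)),
            SAW.criticalFugacity ^ n)
        ≤ η * ∑ n ∈ Finset.range (N' + 1),
          ∑ _ω ∈ (SAW.Zd.sawFun 2 n (![0, (y₂ : ℤ)] - ![0, (y₁ : ℤ)])).filter (fun ω =>
              (∀ i ≤ n, 0 ≤ (![0, (y₁ : ℤ)] + ω i) 0 ∧ 0 ≤ (![0, (y₁ : ℤ)] + ω i) 1 ∧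
                (![0, (y₁ : ℤ)] + ω i) 1 < W) ∧
              (∃ i ≤ n, (W : ℤ) ≤ (![0, (y₁ : ℤ)] + ω i) 0)),
            SAW.criticalFugacity ^ n) →
    ∀ (D : DobrushinDomain) (a b : ℝ → Site 2), SAW.IsEndpointApprox D a b →
      ∃ δ₀ : ℝ, 0 < δ₀ ∧ ∀ (x : ℂ) (ρ R : ℝ), 0 < ρ → ρ < R →
        ∀ ε : ℝ, 0 < ε → ∃ k : ℕ, ∀ δ ∈ Set.Ioc (0 : ℝ) δ₀,
          SAW.law D.carrier δ (a δ) (b δ)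
            {γ | (⟨γ.walk.toCurve (meshPoint δ)⟩ : Curve ℂ).HasTraversals k x ρ R}
              ≤ ENNReal.ofReal ε := by
  sorry

/-- **S6 — PER-SHELL DECAY ⇒ EVENTUAL TIGHTNESS (provable now, M–L; Aizenman–Burchard (2.22) + Lemma 4.1,
both PROVED in tree).** If `PerShellDecay` holds then eventual tightness — the BODY of the route target
`EventualTight` (stmt-CriticalPhenomena-1372), spelled out so that the landed stub is not a conditional
proof of a tagged item; the composition restates it as `EventualTight` by `rfl`-unfolding. Proof
route: fix `(D, a, b)` and the `δ₀` of the hypothesis; `Λ := closure` of a ball containing `Ω = D.carrier`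
(`D.isBounded`; compact), and the SAW polyline of `Ω_δ` has range in `closure Ω ⊆ Λ` (mesh edges are
closed segments in `closure Ω`, `meshGraph_adj_iff`; polyline range = union of those segments). Given
`ε > 0`, for each scale `m` put `a_m := 2^{-m}`, `ρ_m := a_m / 4` (`2ρ_m < a_m`), pick a finite `ρ_m`-net
`S_m` of `Λ` (`exists_finset_card_le_cover_closedBall` or compactness) and for each `y ∈ S_m` the threshold
`k_m(y)` of `PerShellDecay` for the shell `D(y; ρ_m, a_m - ρ_m)` with `ε_{m} := ε 2^{-(m+1)} / |S_m|`.
By `Curve.tortuosity_le_of_cover` (AB (2.22), proved) a polyline with `< k_m(y)` traversals of every such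
shell has `tortuosity (2 a_m) ≤ Φ_m := Σ_{y ∈ S_m} k_m(y)`, so by a union bound
`P_δ[∃ m, tortuosity (2a_m) > Φ_m] ≤ Σ_m |S_m| ε_m = ε` for every `δ ∈ (0, δ₀]`; the set
`𝒦 := closure (mk '' {γ | range γ ⊆ Λ ∧ ∀ m, tortuosity γ (2 a_m) ≤ Φ_m})` is compact
(`CurveClass.isCompact_closure_image_mk_of_tortuosity_le`, AB Lemma 4.1, proved) and carries all but `ε`
of every pushed-forward law (`Measure.le_map_apply`, `SAW.aemeasurable_curve`; laws that are not
probability measures are `0`). Conclude with `isTightMeasureSet_iff_exists_isCompact_measure_compl_le`.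
Sources: AizenmanBurchardDuke1999 Thm 2.5 (2.22), Lemma 4.1; tree `CurveTortuosity.lean`. -/
theorem stub_eventualTight_of_perShellDecay :
    (∀ (D : DobrushinDomain) (a b : ℝ → Site 2), SAW.IsEndpointApprox D a b →
      ∃ δ₀ : ℝ, 0 < δ₀ ∧ ∀ (x : ℂ) (ρ R : ℝ), 0 < ρ → ρ < R →
        ∀ ε : ℝ, 0 < ε → ∃ k : ℕ, ∀ δ ∈ Set.Ioc (0 : ℝ) δ₀,
          SAW.law D.carrier δ (a δ) (b δ)
            {γ | (⟨γ.walk.toCurve (meshPoint δ)⟩ : Curve ℂ).HasTraversals k x ρ R}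
              ≤ ENNReal.ofReal ε) →
    ∀ (D : DobrushinDomain) (a b : ℝ → Site 2), SAW.IsEndpointApprox D a b →
      ∃ δ₀ : ℝ, 0 < δ₀ ∧ MeasureTheory.IsTightMeasureSet
        ((fun δ => (SAW.law D.carrier δ (a δ) (b δ)).map (fun γ => γ.curve)) '' Set.Ioc 0 δ₀) := by
  sorry

/-! ## The composition -/

/-- **Composition**: S1 → S2 → S3 is the strip engine (`TubeMassHyperscaling`), S4 adds hairpin hysteresis,
S5 turns both into per-shell decay, S6 into `EventualTight`; the landed negative lemma
`Negative.not_eventualTight_of_not_shellCrossingBound` (`EventualTight → ShellCrossingBound` in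
refuter-admissible form, p72603) concludes the crux BY NAME. -/
theorem ShellCrossingBound_of : ShellCrossingBound := by
  have hTMH := stub_tubeMass_of_stripDecay (stub_stripDecay_of_tiltedKraft stub_irrBridgeTiltedKraft)
  have hT : EventualTight :=
    stub_eventualTight_of_perShellDecay
      (stub_perShellDecay_of_hairpin hTMH (stub_hairpin_of_tubeMass hTMH))
  by_contra h
  exact Theorems.ShellCrossingBound.Negative.not_eventualTight_of_not_shellCrossingBound h hT

end Summit.CriticalPhenomena.SAWScalingLimit.Cruxes.ShellCrossingBound.KestenDefectRenewal
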